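import Summits.Ventures.PercRepro.C026EdgeMonoDefect

/-!
# THEOREM R (R3): CONJECTURE CM ⟹ C-026's (CF) form (p5, gen 17)

mine-3's CONJECTURE CM (INBOX 6152, `proofs/MINE3-EDGEMONO.md` §2): «contracting an off-mark edge
never increases the C-026 slack», `Δ_CF(H / e) ≤ Δ_CF(H)`. In DC-SUB's vocabulary (C026DCSub):
`H = G + uv` (`G.addEdge u v`), `H / uv = G.contract u v` (the merged vertex is `v`, `u` is left
isolated), `u ∉ {a, b, c}`, `v ∉ {a, b, u}` — every loop-free off-mark edge has such an end `u`.

* `ContractMono a b c` — CONJECTURE CM; `contractMono_iff_dcDefect_le` — CM ⟺ `#DB(uv) ≤ Δ_CF(G)`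
  (mine-3 §2: «(CF) for `H − e` with the room `DB(e)`»);
* `nonMarkSupp_contract_subset`, `card_nonMarkSupp_contract_lt` — contracting an edge at a non-mark
  `u` leaves fewer edge-carrying non-marks (`u` is isolated in the contraction);
* `slackCF_part_of_loops` — dropping `n` loops divides `Δ_CF` by `2^n`; `keepLoopAt`,
  `delEquivOfKeep` — stripping the loops at `u` and deleting `u` afterwards is deleting `u`;
* **`slackCF_nonneg_of_contractMono_of_hubFactor`**, **`slackCF_nonneg_of_contractMono`** —
  THEOREM R (R3): induction on the edge-carrying non-marks; a non-mark `u` with a loop-free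
  off-mark edge `e = ux` is contracted (CM + the induction hypothesis on `H / e`); otherwise every
  loop-free edge at a non-mark goes to `a` or `b`: strip the loops at `u`, (R0) at `u`, the induction
  hypothesis on `H − u`; base = components + isolated marks; `c026_of_contractMono` (every `p`).

The route differs from mine-3's (R3) (contract every off-mark edge, then the pure-hub formula).
-/

universe u v

namespace PercRepro

open Finset

namespace MultiGraph

section ContractMono

variable {V : Type u}

open Classical in
/-- **CONJECTURE CM** (mine-3, INBOX 6152): contracting an off-mark edge `uv` — `u ∉ {a, b, c}`,
`v ∉ {a, b, u}` — never increases `Δ_CF`: `Δ_CF(G / uv) ≤ Δ_CF(G + uv)` with `G / uv = G.contract u v`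
(the merged vertex is `v`), for every marked multigraph on `V` with a finite edge type of the
universe `v`. -/
def ContractMono (a b c : V) : Prop :=
  ∀ (E : Type v) [Fintype E] (G : MultiGraph V E) (u v : V), u ≠ a → u ≠ b → u ≠ c → v ≠ a →
    v ≠ b → v ≠ u → (G.contract u v).slackCF a b c ≤ (G.addEdge u v).slackCF a b c

open Classical in
/-- **CM as the defect bound** (mine-3 §2): CM holds iff `#DB(uv) ≤ Δ_CF(G)` for every marked
multigraph `G`, every non-mark `u` and every `v ∉ {a, b, u}` (through DC-SUB). -/
theorem contractMono_iff_dcDefect_le (a b c : V) :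
    ContractMono.{u, v} a b c ↔
      ∀ (E : Type v) [Fintype E] (G : MultiGraph V E) (u v : V), u ≠ a → u ≠ b → u ≠ c →
        v ≠ a → v ≠ b → v ≠ u →
        ((univ.filter fun ω : Config E => G.DCDefect ω a b c u v).card : ℤ) ≤ G.slackCF a b c := by
  constructor
  · intro h E _ G u v hua hub huc hva hvb hvu
    have := h E G u v hua hub huc hva hvb hvu
    rw [slackCF_addEdge hvu hua.symm hub.symm huc.symm] at this
    linarith
  · intro h E _ G u v hua hub huc hva hvb hvu
    rw [slackCF_addEdge hvu hua.symm hub.symm huc.symm]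
    have := h E G u v hua hub huc hva hvb hvu
    linarith

/-! ### The contraction of an edge at a non-mark has fewer edge-carrying non-marks -/

open Classical in
/-- The edge-carrying non-marks of `(H − e₀) / ux` (`e₀ = ux`) are edge-carrying non-marks of `H`
other than `u`. -/
theorem nonMarkSupp_contract_subset {E : Type v} [Fintype E] (H : MultiGraph V E) {a b c u x : V}
    {e₀ : E} (hux : x ≠ u) (hx : H.EdgeAt e₀ x) :
    ((H.part (delEdgeSide e₀) true).contract u x).nonMarkSupp a b c ⊆
      (H.nonMarkSupp a b c).erase u := by
  intro w hw
  unfold nonMarkSupp at hw ⊢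
  rw [Finset.mem_filter, mem_supp] at hw
  obtain ⟨⟨e, he⟩, hwa, hwb, hwc⟩ := hw
  refine Finset.mem_erase.mpr ⟨?_, Finset.mem_filter.mpr ⟨(mem_supp H w).mpr ?_, hwa, hwb, hwc⟩⟩
  · rcases he with he | he
    · rw [contract_fst] at he
      exact fun h => mergeTo_ne_u hux _ (he.trans h)
    · rw [contract_snd] at he
      exact fun h => mergeTo_ne_u hux _ (he.trans h)
  · rcases he with he | he
    · rw [contract_fst, part_fst] at he
      by_cases h1 : H.fst e.1 = u
      · rw [h1, mergeTo_self] at he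
        exact ⟨e₀, he ▸ hx⟩
      · rw [mergeTo_of_ne h1] at he
        exact ⟨e.1, Or.inl he⟩
    · rw [contract_snd, part_snd] at he
      by_cases h1 : H.snd e.1 = u
      · rw [h1, mergeTo_self] at he
        exact ⟨e₀, he ▸ hx⟩
      · rw [mergeTo_of_ne h1] at he
        exact ⟨e.1, Or.inr he⟩

open Classical in
/-- Contracting an edge `e₀ = ux` at the edge-carrying non-mark `u` strictly lowers the number of
edge-carrying non-marks. -/
theorem card_nonMarkSupp_contract_lt {E : Type v} [Fintype E] (H : MultiGraph V E) {a b c u x : V}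
    {e₀ : E} (hux : x ≠ u) (hx : H.EdgeAt e₀ x) (hmem : u ∈ H.nonMarkSupp a b c) :
    (((H.part (delEdgeSide e₀) true).contract u x).nonMarkSupp a b c).card <
      (H.nonMarkSupp a b c).card :=
  calc (((H.part (delEdgeSide e₀) true).contract u x).nonMarkSupp a b c).card
      ≤ ((H.nonMarkSupp a b c).erase u).card :=
        Finset.card_le_card (nonMarkSupp_contract_subset H hux hx)
    _ < (H.nonMarkSupp a b c).card := Finset.card_erase_lt_of_mem hmem

/-! ### Stripping loops -/

open Classical in
/-- **Dropping `n` loops divides `Δ_CF` by `2^n`.** -/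
theorem slackCF_part_of_loops {E : Type v} [Fintype E] (H : MultiGraph V E) (a b c : V)
    (keep : E → Bool) (hloop : ∀ e, keep e = false → H.fst e = H.snd e) :
    H.slackCF a b c =
      2 ^ (univ.filter fun e => keep e = false).card * (H.part keep true).slackCF a b c := by
  suffices h : ∀ n : ℕ, ∀ keep : E → Bool, (univ.filter fun e => keep e = false).card = n →
      (∀ e, keep e = false → H.fst e = H.snd e) →
      H.slackCF a b c = 2 ^ n * (H.part keep true).slackCF a b c from h _ keep rfl hloop
  intro n
  induction n with
  | zero =>
    intro keep hn _
    have hall : ∀ e, keep e = true := by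
      intro e
      by_contra h
      have hmem : e ∈ univ.filter fun e => keep e = false := by
        simp only [Finset.mem_filter, Finset.mem_univ, true_and]
        exact Bool.eq_false_iff.mpr h
      rw [Finset.card_eq_zero] at hn
      rw [hn] at hmem
      exact Finset.notMem_empty e hmem
    rw [slackCF_relabel (isRelabel_part_of_forall H keep hall), pow_zero, one_mul]
  | succ n ih =>
    intro keep hn hloop
    obtain ⟨e₀, he₀⟩ : ∃ e, keep e = false := by
      obtain ⟨e, he⟩ :=
        Finset.card_pos.1 (by omega : 0 < (univ.filter fun e => keep e = false).card)
      exact ⟨e, (Finset.mem_filter.1 he).2⟩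
    have hn' : (univ.filter fun e => keepInsert keep e₀ e = false).card = n := by
      have hset : (univ.filter fun e => keepInsert keep e₀ e = false) =
          (univ.filter fun e => keep e = false).erase e₀ := by
        ext e
        simp only [Finset.mem_filter, Finset.mem_univ, true_and, Finset.mem_erase,
          keepInsert_eq_false_iff]
        tauto
      rw [hset, Finset.card_erase_of_mem (by simpa using he₀), hn]
      rfl
    have hloop' : ∀ e, keepInsert keep e₀ e = false → H.fst e = H.snd e :=
      fun e he => hloop e ((keepInsert_eq_false_iff keep e₀ e).1 he).1
    have h1 := ih _ hn' hloop'
    have h2 := slackCF_loop (H.part (keepInsert keep e₀) true)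
      (e := ⟨e₀, keepInsert_self keep e₀⟩) (hloop e₀ he₀) a b c
    rw [slackCF_relabel (isRelabel_delEdge H keep he₀)] at h2
    rw [h1, h2, pow_succ]
    ring

open Classical in
/-- Keeping every edge except the loops at `u`. -/
noncomputable def keepLoopAt {E : Type v} (H : MultiGraph V E) (u : V) : E → Bool :=
  fun e => decide (¬ (H.EdgeAt e u ∧ H.fst e = H.snd e))

/-- `keepLoopAt` drops exactly the loops at `u`. -/
theorem keepLoopAt_eq_false_iff {E : Type v} (H : MultiGraph V E) (u : V) (e : E) :
    H.keepLoopAt u e = false ↔ H.EdgeAt e u ∧ H.fst e = H.snd e := by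
  unfold keepLoopAt
  simp

open Classical in
/-- `keepLoopAt` keeps every edge not at `u`. -/
theorem keepLoopAt_of_not_edgeAt {E : Type v} (H : MultiGraph V E) (u : V) (e : E)
    (h : ¬ H.EdgeAt e u) : H.keepLoopAt u e = true := by
  unfold keepLoopAt
  rw [decide_eq_true_iff]
  exact fun h' => h h'.1

open Classical in
/-- If `keep` keeps every edge not at `u`, the edges not at `u` of `H.part keep true` are the edges
not at `u` of `H`. -/
noncomputable def delEquivOfKeep {E : Type v} (H : MultiGraph V E) (keep : E → Bool) (u : V)
    (hk : ∀ e, ¬ H.EdgeAt e u → keep e = true) :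
    {x : {e // keep e = true} // (H.part keep true).delSide u x = true} ≃
      {e // H.delSide u e = true} where
  toFun x := ⟨x.1.1, by
    have h := x.2
    unfold delSide at h ⊢
    rw [decide_eq_true_iff] at h ⊢
    exact h⟩
  invFun y := ⟨⟨y.1, by
      have h := y.2
      unfold delSide at h
      rw [decide_eq_true_iff] at h
      exact hk y.1 h⟩, by
      have h := y.2
      unfold delSide at h ⊢
      rw [decide_eq_true_iff] at h ⊢
      exact h⟩
  left_inv x := Subtype.ext (Subtype.ext rfl)
  right_inv y := Subtype.ext rfl

open Classical in
/-- Deleting `u` from `H.part keep true` is a relabelling of `H − u` when `keep` keeps every edge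
not at `u`. -/
theorem isRelabel_delOfKeep {E : Type v} (H : MultiGraph V E) (keep : E → Bool) (u : V)
    (hk : ∀ e, ¬ H.EdgeAt e u → keep e = true) :
    IsRelabel ((H.part keep true).part ((H.part keep true).delSide u) true)
      (H.part (H.delSide u) true) (delEquivOfKeep H keep u hk) :=
  fun _ => ⟨rfl, rfl⟩

/-! ### THEOREM R (R3) -/

open Classical in
/-- The induction of (R3): CM + the hub factor give (CF) for every marked multigraph with `m`
edge-carrying non-marks. -/
theorem slackCF_nonneg_of_contractMono_aux {a b c : V} (hF : HubFactor.{u, v} a b c)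
    (hC : ContractMono.{u, v} a b c) (m : ℕ) :
    ∀ (E : Type v) [Fintype E] (G : MultiGraph V E), (G.nonMarkSupp a b c).card = m →
      0 ≤ G.slackCF a b c := by
  induction m using Nat.strong_induction_on with
  | _ m ih =>
    intro E _ G hm
    by_cases hA : ∃ u, u ≠ a ∧ u ≠ b ∧ u ≠ c ∧
        ∃ e, G.EdgeAt e u ∧ G.fst e ≠ G.snd e ∧ ¬ G.EdgeAt e a ∧ ¬ G.EdgeAt e b
    · -- a non-mark `u` with a loop-free off-mark edge `e`: contract `e` at `u`
      obtain ⟨u, hua, hub, huc, e, heu, hl, hea, heb⟩ := hA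
      have hmem : u ∈ G.nonMarkSupp a b c :=
        Finset.mem_filter.mpr ⟨(mem_supp G u).mpr ⟨e, heu⟩, hua, hub, huc⟩
      rcases heu with hfu | hsu
      · -- `e = u (snd e)`
        have hx : G.snd e ≠ u := fun h => hl (hfu.trans h.symm)
        have hxa : G.snd e ≠ a := fun h => hea (Or.inr h)
        have hxb : G.snd e ≠ b := fun h => heb (Or.inr h)
        have hcm := hC _ (G.part (delEdgeSide e) true) u (G.snd e) hua hub huc hxa hxb hx
        have hrel := slackCF_relabel (isRelabel_addEdge_delEdge G e) a b c
        rw [hfu] at hrel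
        rw [hrel] at hcm
        have hlt := card_nonMarkSupp_contract_lt G (a := a) (b := b) (c := c) hx (Or.inr rfl) hmem
        rw [hm] at hlt
        exact (ih _ hlt _ _ rfl).trans hcm
      · -- `e = (fst e) u`: the orientation swap
        have hx : G.fst e ≠ u := fun h => hl (h.trans hsu.symm)
        have hxa : G.fst e ≠ a := fun h => hea (Or.inl h)
        have hxb : G.fst e ≠ b := fun h => heb (Or.inl h)
        have hcm := hC _ (G.part (delEdgeSide e) true) u (G.fst e) hua hub huc hxa hxb hx
        have hrel := slackCF_relabel' (isRelabel'_addEdge_delEdge_swap G e) a b c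
        rw [hsu] at hrel
        rw [hrel] at hcm
        have hlt := card_nonMarkSupp_contract_lt G (a := a) (b := b) (c := c) hx (Or.inl rfl) hmem
        rw [hm] at hlt
        exact (ih _ hlt _ _ rfl).trans hcm
    · -- every loop-free edge at a non-mark goes to `a` or `b`
      have hB : ∀ u, u ≠ a → u ≠ b → u ≠ c → ∀ e, G.EdgeAt e u → G.fst e ≠ G.snd e →
          G.EdgeAt e a ∨ G.EdgeAt e b := by
        intro u hua hub huc e heu hl
        by_contra hcon
        push Not at hcon
        exact hA ⟨u, hua, hub, huc, e, heu, hl, hcon.1, hcon.2⟩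
      by_cases hu : ∃ u, u ∈ G.nonMarkSupp a b c
      · -- strip the loops at an edge-carrying non-mark `u`, then (R0) at `u`
        obtain ⟨u, hmem⟩ := hu
        obtain ⟨_, hua, hub, huc⟩ := Finset.mem_filter.1 hmem
        have hloops := slackCF_part_of_loops G a b c (G.keepLoopAt u)
          (fun e he => ((keepLoopAt_eq_false_iff G u e).1 he).2)
        have hhub : ∀ e', (G.part (G.keepLoopAt u) true).EdgeAt e' u →
            (G.part (G.keepLoopAt u) true).EdgeAt e' a ∨
              (G.part (G.keepLoopAt u) true).EdgeAt e' b := by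
          intro e' he'
          have hk := e'.2
          unfold keepLoopAt at hk
          rw [decide_eq_true_iff] at hk
          exact hB u hua hub huc e'.1 he' fun h => hk ⟨he', h⟩
        obtain ⟨k, hk1, hk⟩ := hF _ (G.part (G.keepLoopAt u) true) u hua hub huc hhub
        rw [slackCF_relabel (isRelabel_delOfKeep G (G.keepLoopAt u) u
          (keepLoopAt_of_not_edgeAt G u))] at hk
        have hlt := card_nonMarkSupp_del_lt G (a := a) (b := b) (c := c) hmem
        rw [hm] at hlt
        have h1 := ih _ hlt _ (G.part (G.delSide u) true) rfl
        rw [hloops, hk]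
        exact mul_nonneg (pow_nonneg (by norm_num) _) (mul_nonneg (by linarith) h1)
      · -- no edge-carrying non-mark: the base of the MONO induction
        push Not at hu
        refine slackCF_nonneg_of_components a b c fun κ _ => ?_
        refine slackCF_nonneg_of_isolated (Or.inl fun e' he' => ?_)
        have he'a : G.EdgeAt e'.1 a := he'
        rcases nonMark_end_of_compColour_inl e'.2 with hw | hw
        · simp only [Set.mem_insert_iff, Set.mem_singleton_iff, not_or] at hw
          exact hu (G.fst e'.1) (Finset.mem_filter.mpr
            ⟨(mem_supp G _).mpr ⟨e'.1, Or.inl rfl⟩, hw.1, hw.2.1, hw.2.2⟩)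
        · simp only [Set.mem_insert_iff, Set.mem_singleton_iff, not_or] at hw
          exact hu (G.snd e'.1) (Finset.mem_filter.mpr
            ⟨(mem_supp G _).mpr ⟨e'.1, Or.inr rfl⟩, hw.1, hw.2.1, hw.2.2⟩)

/-- **THEOREM R (R3), modulo the hub factor**: CONJECTURE CM gives `0 ≤ Δ_CF` on every marked
multigraph. -/
theorem slackCF_nonneg_of_contractMono_of_hubFactor {a b c : V} (hF : HubFactor.{u, v} a b c)
    (hC : ContractMono.{u, v} a b c) {E : Type v} [Fintype E] (G : MultiGraph V E) :
    0 ≤ G.slackCF a b c :=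
  slackCF_nonneg_of_contractMono_aux hF hC _ E G rfl

/-- **THEOREM R (R3)** (mine-3, INBOX 6152): CONJECTURE CM — contracting an off-mark edge never
increases `Δ_CF` — gives C-026's (CF) form on every marked multigraph on `V` with marks `a, b, c`. -/
theorem slackCF_nonneg_of_contractMono {a b c : V} (hC : ContractMono.{u, v} a b c) {E : Type v}
    [Fintype E] (G : MultiGraph V E) : 0 ≤ G.slackCF a b c :=
  slackCF_nonneg_of_contractMono_of_hubFactor (hubFactor a b c) hC G

/-- CONJECTURE CM for every marking gives C-026 at every edge weight. -/
theorem c026_of_contractMono (hC : ∀ (V' : Type u) (a b c : V'), ContractMono.{u, v} a b c)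
    {E : Type v} [Fintype E] [DecidableEq E] (G : MultiGraph V E) (a b c : V) (p : E → ℝ)
    (hp : IsProb p) :
    (G.law3 p a b c 0 + G.law3 p a b c 1) * (G.law3 p a b c 1 + G.law3 p a b c 4) ≤
      G.law3 p a b c 1 + G.law3 p a b c 2 + G.law3 p a b c 3 :=
  c026_of_slackCF_all (fun V' _ _ H a b c => slackCF_nonneg_of_contractMono (hC V' a b c) H)
    G a b c p hp

end ContractMono

end MultiGraph

end PercRepro
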